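import Literature.NumberTheory.EllipticCurves.ImaginaryPeriod
import Literature.NumberTheory.EllipticCurves.EisensteinLatticeCMThree
import Literature.NumberTheory.EllipticCurves.RealLatticeCovolumeProofs
import HarnessLib

set_option linter.dupNamespace false -- `Summit.BirchSwinnertonDyer.BirchSwinnertonDyer.Theorems.…` (summit = sub, D-0017)
set_option autoImplicit false

/-!
# Néron-type periods of the sextic (Mordell) MODELS `y² = x³ + k`: `Ω⁺ = ϖ₁|k|^{−1/6}`, `|Ω⁻| = √3·ϖ₁|k|^{−1/6}` (`k < 0`),
# `Ω⁺ = √3·ϖ₁k^{−1/6}`, `|Ω⁻| = ϖ₁k^{−1/6}` (`k > 0`), `ϖ₁ = 2^{2/3}Γ(1/3)³/(4π)` — the period side of the `j = 0` cell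

Crux `ManinDatumSupercuspidalCMInert` (stmt-BirchSwinnertonDyer-20111, BED r605), stub `stub_S5` (`j = 0` at `p = 5`); route
`BiquadraticEisensteinDescent` (cell `pub/bsd-wall`, width seat `bsd-wall-cm-bed-w1` g8; `--supports` stmt-BirchSwinnertonDyer-20111, helper).
The `j = 0` twin of `…InertBadAtThreeQuarticModelPeriods` (bed-w3 g8, the quartic models `y² = x³ + Ax` and `ϖ₀`): the sextic assembly
`T₅ ⟹ H₅` (model odd `L`-values of `⟨0,0,0,0,k⟩`, `5 ∣ k` sixth-power-free) divides by `i·Ω⁻(⟨0,0,0,0,k⟩)`, and this file computes the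
model's periods EXACTLY in the currency `ϖ₁` of the CM core `…ResolventCertificateJZero.core_rho_of_character` (no power of `2` or `3`
hidden, no minimalisation):

* §1 lattice lemmas for `Λ = ℤρ + ℤ` (`PeriodPair.ofUpperHalfPlane UpperHalfPlane.ρ`): `minRealPeriod_mulLeft_I_rho` — the least positive real
  period of `iΛ` is `√3` (`Λ ∩ iℝ = ℤ√−3`); `lattice_mulLeft_I_mulLeft_I` (`i(iΛ′) = Λ′` for any lattice), `lattice_mulLeft_comm`.
* §2 over `ℝ`, `a ≠ 0`, `E_a = ⟨0,0,0,0,a⟩` (`c₄ = 0`, `c₆ = −864a`, `Δ = −432a²`, one real component): the period lattice is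
  `ϖ₁|a|^{−1/6}·Λ` for `a < 0` (`g₂ = 0`, `g₃ = 4ϖ₁⁶·|a| = −4a = c₆/216`, Lit `EisensteinLattice.g₃_eq_four_mul_varpi₁_pow_six`) and
  `ϖ₁a^{−1/6}·iΛ` for `a > 0` (`g₃(iΛ) = −g₃(Λ)`); whence `realPeriod_sextic_of_neg/pos`, `imaginaryPeriod_sextic_of_neg/pos`
  (`realPeriod_eq_numRealComponents_mul_minRealPeriod`, `imaginaryPeriod_eq`, `EisensteinLattice.minRealPeriod_eq = 1`, §1).
* §3 over `ℚ`, `k ∈ ℤ ∖ 0`: `realPeriodRat_sextic_of_neg/pos`, `imaginaryPeriodRat_sextic_of_neg/pos`, and the assembly-shaped corollary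
  `exists_imaginaryPeriodRat_sextic`: `Ω⁻(⟨0,0,0,0,k⟩) = c·ϖ₁·|k|^{−1/6}` with `c ∈ {√3, 1}`, so `3/c` is an algebraic integer (a `5`-adic unit
  up to `√3`); §4 `isIntegral_rpow_sixth`, `inv_abs_rpow_neg_sixth_of_eq` (`|k|^{1/6} = q^{e/6}·k₁^{1/6}` for `|k| = q^e k₁`),
  `natCast_cpow_sixth_mul_cpow_sixth_of_le` (`q^{e/6}·q^{(6−e)/6} = q`) — the period bookkeeping of the future `oddLValue_sextic_of_dictionary`.

HONEST FRAMING: nothing here proves the stub, the crux, Manin's conjecture or BSD. No definition, no named fact, no `sorry`; axioms standard.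
[cite: SilvermanAEC2009, Thm VI.5.1 and C.16] [cite: CremonaAlgorithms1997, §3.7] [cite: Pal2012, p. 1514]
-/

noncomputable section

open Complex PeriodPair WeierstrassCurve
open Literature.NumberTheory.EllipticCurves

namespace Summit.BirchSwinnertonDyer.BirchSwinnertonDyer.Theorems.BiquadraticEisensteinDescentManinDatumSupercuspidalCMInertSexticModelPeriods

-- No notation (typer lint): `ϖ₁ = 2^{2/3}Γ(1/3)³/(4π)` is written out as `(2 : ℝ) ^ (2 / 3 : ℝ) * Real.Gamma (1 / 3) ^ 3 / (4 * Real.pi)`.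

/-! ## §1 Lattice lemmas for `ℤρ + ℤ` -/

section Lattice

/-- The real points of `i(ℤρ + ℤ)`: `t ∈ i(ℤρ + ℤ)` iff `t ∈ ℤ√3` (`ℤρ + ℤ ∩ iℝ = ℤ(2ρ + 1) = ℤ√−3`). [folklore] -/
theorem ofReal_mem_mulLeft_I_lattice_iff (t : ℝ) :
    (t : ℂ) ∈ ((PeriodPair.ofUpperHalfPlane UpperHalfPlane.ρ).mulLeft I I_ne_zero).lattice ↔ ∃ n : ℤ, (n : ℝ) * Real.sqrt 3 = t := by
  have hρ : ((UpperHalfPlane.ρ : UpperHalfPlane) : ℂ) = ⟨-1 / 2, Real.sqrt 3 / 2⟩ := rfl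
  rw [mem_mulLeft_lattice, EisensteinLattice.mem_lattice_iff, Complex.inv_I]
  constructor
  · rintro ⟨m, n, h⟩
    have hre := congrArg Complex.re h
    have him := congrArg Complex.im h
    rw [hρ] at hre him
    simp only [Complex.add_re, Complex.mul_re, Complex.intCast_re, Complex.intCast_im, zero_mul, sub_zero,
      Complex.neg_re, Complex.neg_im, Complex.I_re, Complex.I_im, Complex.ofReal_re, Complex.ofReal_im, mul_zero, neg_zero,
      Complex.add_im, Complex.mul_im, zero_add, add_zero] at hre him
    refine ⟨-n, ?_⟩
    have hm : (m : ℝ) = 2 * n := by linarith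
    rw [hm] at him
    push_cast
    linarith
  · rintro ⟨n, rfl⟩
    refine ⟨-(2 * n), -n, ?_⟩
    rw [hρ]
    apply Complex.ext
    · simp; ring
    · simp; ring

/-- **The least positive real period of `i(ℤρ + ℤ)` is `√3`.** [folklore] -/
theorem minRealPeriod_mulLeft_I_rho :
    ((PeriodPair.ofUpperHalfPlane UpperHalfPlane.ρ).mulLeft I I_ne_zero).minRealPeriod = Real.sqrt 3 := by
  have hs0 : 0 < Real.sqrt 3 := Real.sqrt_pos.mpr (by norm_num)
  have h3 : Real.sqrt 3 ∈ ((PeriodPair.ofUpperHalfPlane UpperHalfPlane.ρ).mulLeft I I_ne_zero).realPeriods :=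
    ⟨hs0, (ofReal_mem_mulLeft_I_lattice_iff _).mpr ⟨1, by simp⟩⟩
  have hleast : IsLeast ((PeriodPair.ofUpperHalfPlane UpperHalfPlane.ρ).mulLeft I I_ne_zero).realPeriods (Real.sqrt 3) := by
    refine ⟨h3, fun t ht ↦ ?_⟩
    obtain ⟨ht0, htmem⟩ := ht
    obtain ⟨n, rfl⟩ := (ofReal_mem_mulLeft_I_lattice_iff t).mp htmem
    have hn : (0 : ℝ) < n := pos_of_mul_pos_left ht0 hs0.le
    have hn1 : (1 : ℤ) ≤ n := by exact_mod_cast hn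
    have hn1' : (1 : ℝ) ≤ n := by exact_mod_cast hn1
    nlinarith
  rw [PeriodPair.minRealPeriod]
  exact hleast.csInf_eq

/-- `i(iΛ) = −Λ = Λ` as lattices. [folklore] -/
theorem lattice_mulLeft_I_mulLeft_I (L : PeriodPair) :
    ((L.mulLeft I I_ne_zero).mulLeft I I_ne_zero).lattice = L.lattice := by
  ext x
  simp only [mem_mulLeft_lattice, Complex.inv_I]
  rw [show -I * (-I * x) = -x by linear_combination x * Complex.I_sq]
  exact neg_mem_iff

/-- Homotheties commute on lattices: `b(aΛ) = a(bΛ)`. [folklore] -/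
theorem lattice_mulLeft_comm (L : PeriodPair) {a b : ℂ} (ha : a ≠ 0) (hb : b ≠ 0) :
    ((L.mulLeft a ha).mulLeft b hb).lattice = ((L.mulLeft b hb).mulLeft a ha).lattice := by
  ext x
  simp only [mem_mulLeft_lattice]
  rw [mul_left_comm]

end Lattice

/-! ## §2 The sextic models over `ℝ` -/

section Real

variable (a : ℝ)

/-- `c₄(y² = x³ + a) = 0`. [cite: SilvermanAEC2009, III.1] -/
theorem sextic_c₄ : (⟨0, 0, 0, 0, a⟩ : WeierstrassCurve ℝ).c₄ = 0 := by
  simp only [WeierstrassCurve.c₄, WeierstrassCurve.b₂, WeierstrassCurve.b₄]; ring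

/-- `c₆(y² = x³ + a) = −864a`. [cite: SilvermanAEC2009, III.1] -/
theorem sextic_c₆ : (⟨0, 0, 0, 0, a⟩ : WeierstrassCurve ℝ).c₆ = -864 * a := by
  simp only [WeierstrassCurve.c₆, WeierstrassCurve.b₂, WeierstrassCurve.b₄, WeierstrassCurve.b₆]; ring

/-- `Δ(y² = x³ + a) = −432a²`. [cite: SilvermanAEC2009, III.1] -/
theorem sextic_Δ : (⟨0, 0, 0, 0, a⟩ : WeierstrassCurve ℝ).Δ = -432 * a ^ 2 := by
  simp only [WeierstrassCurve.Δ, WeierstrassCurve.b₂, WeierstrassCurve.b₄, WeierstrassCurve.b₆, WeierstrassCurve.b₈]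
  ring

/-- `y² = x³ + a` is elliptic for `a ≠ 0`. [cite: SilvermanAEC2009, III.1] -/
theorem sextic_isElliptic (ha : a ≠ 0) : (⟨0, 0, 0, 0, a⟩ : WeierstrassCurve ℝ).IsElliptic :=
  ⟨by rw [isUnit_iff_ne_zero, sextic_Δ]; exact mul_ne_zero (by norm_num) (pow_ne_zero 2 ha)⟩

/-- `y² = x³ + a` has one real component (`Δ < 0`). [cite: CremonaAlgorithms1997, §3.7] -/
theorem sextic_numRealComponents : (⟨0, 0, 0, 0, a⟩ : WeierstrassCurve ℝ).numRealComponents = 1 :=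
  numRealComponents_of_Δ_nonpos _ (by rw [sextic_Δ]; nlinarith [sq_nonneg a])

/-- The scaling factor `ϖ₁·|a|^{−1/6}` is positive. [folklore] -/
theorem varpi_mul_rpow_pos (ha : a ≠ 0) :
    0 < ((2 : ℝ) ^ (2 / 3 : ℝ) * Real.Gamma (1 / 3) ^ 3 / (4 * Real.pi)) * |a| ^ (-(1 / 6 : ℝ)) :=
  mul_pos EisensteinLattice.varpi₁_pos (Real.rpow_pos_of_pos (abs_pos.mpr ha) _)

/-- `(|a|^{−1/6})⁶ = |a|⁻¹`. [folklore] -/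
theorem rpow_neg_sixth_pow_six : (|a| ^ (-(1 / 6 : ℝ))) ^ 6 = |a|⁻¹ := by
  rw [← Real.rpow_natCast, ← Real.rpow_mul (abs_nonneg a)]
  norm_num
  exact Real.rpow_neg_one |a|

/-- The lattice `ϖ₁|a|^{−1/6}·(ℤρ + ℤ)` has `g₂ = 0 = c₄/12`. [cite: SilvermanAEC2009, VI.3 and proof of Cor. VI.5.1.1] -/
theorem g₂_lattice_of_neg (ha : a ≠ 0) :
    ((PeriodPair.ofUpperHalfPlane UpperHalfPlane.ρ).mulLeft
        ((((2 : ℝ) ^ (2 / 3 : ℝ) * Real.Gamma (1 / 3) ^ 3 / (4 * Real.pi)) * |a| ^ (-(1 / 6 : ℝ)) : ℝ) : ℂ)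
        (by exact_mod_cast (varpi_mul_rpow_pos a ha).ne')).g₂ =
      (((⟨0, 0, 0, 0, a⟩ : WeierstrassCurve ℝ).c₄ / 12 : ℝ) : ℂ) := by
  rw [g₂_mulLeft, PeriodPair.g₂_ofUpperHalfPlane_ρ, mul_zero, sextic_c₄]
  simp

/-- The lattice `ϖ₁|a|^{−1/6}·(ℤρ + ℤ)`, `a < 0`, has `g₃ = 4ϖ₁⁶|a| = −4a = c₆/216`. [cite: SilvermanAEC2009, VI.3 and proof of Cor. VI.5.1.1] -/
theorem g₃_lattice_of_neg (ha : a < 0) :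
    ((PeriodPair.ofUpperHalfPlane UpperHalfPlane.ρ).mulLeft
        ((((2 : ℝ) ^ (2 / 3 : ℝ) * Real.Gamma (1 / 3) ^ 3 / (4 * Real.pi)) * |a| ^ (-(1 / 6 : ℝ)) : ℝ) : ℂ)
        (by exact_mod_cast (varpi_mul_rpow_pos a ha.ne).ne')).g₃ =
      (((⟨0, 0, 0, 0, a⟩ : WeierstrassCurve ℝ).c₆ / 216 : ℝ) : ℂ) := by
  rw [g₃_mulLeft, EisensteinLattice.g₃_eq_four_mul_varpi₁_pow_six, sextic_c₆]
  have hϖ : ((2 : ℝ) ^ (2 / 3 : ℝ) * Real.Gamma (1 / 3) ^ 3 / (4 * Real.pi)) ≠ 0 := EisensteinLattice.varpi₁_pos.ne'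
  have hr : (|a| ^ (-(1 / 6 : ℝ)) : ℝ) ≠ 0 := (Real.rpow_pos_of_pos (abs_pos.mpr ha.ne) _).ne'
  have h6 := rpow_neg_sixth_pow_six a
  have habs : |a| = -a := abs_of_neg ha
  have key : ((((2 : ℝ) ^ (2 / 3 : ℝ) * Real.Gamma (1 / 3) ^ 3 / (4 * Real.pi)) * |a| ^ (-(1 / 6 : ℝ)) : ℝ) ^ 6)⁻¹ *
      (4 * ((2 : ℝ) ^ (2 / 3 : ℝ) * Real.Gamma (1 / 3) ^ 3 / (4 * Real.pi)) ^ 6) = (-864 * a / 216 : ℝ) := by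
    rw [mul_pow, h6, habs]
    field_simp
    ring
  have := congrArg (fun x : ℝ ↦ (x : ℂ)) key
  push_cast at this ⊢
  exact this

/-- `i⁶ = −1`. [folklore] -/
private theorem I_pow_six' : (I : ℂ) ^ 6 = -1 := by
  rw [show (6 : ℕ) = 2 * 3 from rfl, pow_mul, Complex.I_sq]; norm_num

/-- The lattice `ϖ₁a^{−1/6}·i(ℤρ + ℤ)` has `g₂ = 0 = c₄/12`. [cite: SilvermanAEC2009, VI.3 and proof of Cor. VI.5.1.1] -/
theorem g₂_lattice_of_pos (ha : a ≠ 0) :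
    (((PeriodPair.ofUpperHalfPlane UpperHalfPlane.ρ).mulLeft I I_ne_zero).mulLeft
        ((((2 : ℝ) ^ (2 / 3 : ℝ) * Real.Gamma (1 / 3) ^ 3 / (4 * Real.pi)) * |a| ^ (-(1 / 6 : ℝ)) : ℝ) : ℂ)
        (by exact_mod_cast (varpi_mul_rpow_pos a ha).ne')).g₂ =
      (((⟨0, 0, 0, 0, a⟩ : WeierstrassCurve ℝ).c₄ / 12 : ℝ) : ℂ) := by
  rw [g₂_mulLeft, g₂_mulLeft, PeriodPair.g₂_ofUpperHalfPlane_ρ, mul_zero, mul_zero, sextic_c₄]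
  simp

/-- The lattice `ϖ₁a^{−1/6}·i(ℤρ + ℤ)`, `a > 0`, has `g₃ = −4ϖ₁⁶·a·ϖ₁⁻⁶ = −4a = c₆/216` (`g₃(iΛ) = −g₃(Λ)`).
[cite: SilvermanAEC2009, VI.3 and proof of Cor. VI.5.1.1] -/
theorem g₃_lattice_of_pos (ha : 0 < a) :
    (((PeriodPair.ofUpperHalfPlane UpperHalfPlane.ρ).mulLeft I I_ne_zero).mulLeft
        ((((2 : ℝ) ^ (2 / 3 : ℝ) * Real.Gamma (1 / 3) ^ 3 / (4 * Real.pi)) * |a| ^ (-(1 / 6 : ℝ)) : ℝ) : ℂ)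
        (by exact_mod_cast (varpi_mul_rpow_pos a ha.ne').ne')).g₃ =
      (((⟨0, 0, 0, 0, a⟩ : WeierstrassCurve ℝ).c₆ / 216 : ℝ) : ℂ) := by
  rw [g₃_mulLeft, g₃_mulLeft, EisensteinLattice.g₃_eq_four_mul_varpi₁_pow_six, sextic_c₆, I_pow_six']
  have hϖ : ((2 : ℝ) ^ (2 / 3 : ℝ) * Real.Gamma (1 / 3) ^ 3 / (4 * Real.pi)) ≠ 0 := EisensteinLattice.varpi₁_pos.ne'
  have hr : (|a| ^ (-(1 / 6 : ℝ)) : ℝ) ≠ 0 := (Real.rpow_pos_of_pos (abs_pos.mpr ha.ne') _).ne'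
  have h6 := rpow_neg_sixth_pow_six a
  have habs : |a| = a := abs_of_pos ha
  have key : ((((2 : ℝ) ^ (2 / 3 : ℝ) * Real.Gamma (1 / 3) ^ 3 / (4 * Real.pi)) * |a| ^ (-(1 / 6 : ℝ)) : ℝ) ^ 6)⁻¹ *
      ((-1 : ℝ)⁻¹ * (4 * ((2 : ℝ) ^ (2 / 3 : ℝ) * Real.Gamma (1 / 3) ^ 3 / (4 * Real.pi)) ^ 6)) = (-864 * a / 216 : ℝ) := by
    rw [mul_pow, h6, habs]
    field_simp
    ring
  have := congrArg (fun x : ℝ ↦ (x : ℂ)) key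
  push_cast at this ⊢
  exact this

/-- ★ **`Ω⁺(y² = x³ + a) = ϖ₁|a|^{−1/6}` for `a < 0`** (one real component, lattice `ϖ₁|a|^{−1/6}(ℤρ + ℤ)`, `Ω₀(ℤρ + ℤ) = 1`).
[cite: SilvermanAEC2009, Thm VI.5.1 and C.16] [cite: CremonaAlgorithms1997, §3.7] -/
theorem realPeriod_sextic_of_neg (ha : a < 0) :
    (⟨0, 0, 0, 0, a⟩ : WeierstrassCurve ℝ).realPeriod =
      ((2 : ℝ) ^ (2 / 3 : ℝ) * Real.Gamma (1 / 3) ^ 3 / (4 * Real.pi)) * |a| ^ (-(1 / 6 : ℝ)) := by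
  haveI := sextic_isElliptic a ha.ne
  have hc := varpi_mul_rpow_pos a ha.ne
  rw [realPeriod_eq_numRealComponents_mul_minRealPeriod (⟨0, 0, 0, 0, a⟩ : WeierstrassCurve ℝ)
      (g₂_lattice_of_neg a ha.ne) (g₃_lattice_of_neg a ha),
    minRealPeriod_mulLeft_ofReal _ hc, EisensteinLattice.minRealPeriod_eq, mul_one, sextic_numRealComponents a]
  push_cast; ring

/-- ★ **`|Ω⁻(y² = x³ + a)| = √3·ϖ₁|a|^{−1/6}` for `a < 0`** (`Ω₀(i(ℤρ + ℤ)) = √3`). [cite: Pal2012, p. 1514] [cite: SilvermanAEC2009, Thm VI.5.1] -/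
theorem imaginaryPeriod_sextic_of_neg (ha : a < 0) :
    (⟨0, 0, 0, 0, a⟩ : WeierstrassCurve ℝ).imaginaryPeriod =
      Real.sqrt 3 * (((2 : ℝ) ^ (2 / 3 : ℝ) * Real.Gamma (1 / 3) ^ 3 / (4 * Real.pi)) * |a| ^ (-(1 / 6 : ℝ))) := by
  haveI := sextic_isElliptic a ha.ne
  have hc := varpi_mul_rpow_pos a ha.ne
  rw [imaginaryPeriod_eq (⟨0, 0, 0, 0, a⟩ : WeierstrassCurve ℝ) (g₂_lattice_of_neg a ha.ne) (g₃_lattice_of_neg a ha),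
    minRealPeriod_eq_of_lattice_eq (lattice_mulLeft_comm _ _ _), minRealPeriod_mulLeft_ofReal _ hc, minRealPeriod_mulLeft_I_rho]
  ring

/-- ★ **`Ω⁺(y² = x³ + a) = √3·ϖ₁a^{−1/6}` for `a > 0`** (one real component, lattice `ϖ₁a^{−1/6}·i(ℤρ + ℤ)`).
[cite: SilvermanAEC2009, Thm VI.5.1 and C.16] [cite: CremonaAlgorithms1997, §3.7] -/
theorem realPeriod_sextic_of_pos (ha : 0 < a) :
    (⟨0, 0, 0, 0, a⟩ : WeierstrassCurve ℝ).realPeriod =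
      Real.sqrt 3 * (((2 : ℝ) ^ (2 / 3 : ℝ) * Real.Gamma (1 / 3) ^ 3 / (4 * Real.pi)) * |a| ^ (-(1 / 6 : ℝ))) := by
  haveI := sextic_isElliptic a ha.ne'
  have hc := varpi_mul_rpow_pos a ha.ne'
  rw [realPeriod_eq_numRealComponents_mul_minRealPeriod (⟨0, 0, 0, 0, a⟩ : WeierstrassCurve ℝ)
      (g₂_lattice_of_pos a ha.ne') (g₃_lattice_of_pos a ha),
    minRealPeriod_mulLeft_ofReal _ hc, minRealPeriod_mulLeft_I_rho, sextic_numRealComponents a]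
  push_cast; ring

/-- ★ **`|Ω⁻(y² = x³ + a)| = ϖ₁a^{−1/6}` for `a > 0`** (`i·(c·iΛ) = cΛ`, `Ω₀(ℤρ + ℤ) = 1`). [cite: Pal2012, p. 1514] [cite: SilvermanAEC2009, Thm VI.5.1] -/
theorem imaginaryPeriod_sextic_of_pos (ha : 0 < a) :
    (⟨0, 0, 0, 0, a⟩ : WeierstrassCurve ℝ).imaginaryPeriod =
      ((2 : ℝ) ^ (2 / 3 : ℝ) * Real.Gamma (1 / 3) ^ 3 / (4 * Real.pi)) * |a| ^ (-(1 / 6 : ℝ)) := by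
  haveI := sextic_isElliptic a ha.ne'
  have hc := varpi_mul_rpow_pos a ha.ne'
  have hc0 : (((((2 : ℝ) ^ (2 / 3 : ℝ) * Real.Gamma (1 / 3) ^ 3 / (4 * Real.pi)) * |a| ^ (-(1 / 6 : ℝ)) : ℝ)) : ℂ) ≠ 0 := by
    exact_mod_cast hc.ne'
  have hlat : ((((PeriodPair.ofUpperHalfPlane UpperHalfPlane.ρ).mulLeft I I_ne_zero).mulLeft _ hc0).mulLeft I I_ne_zero).lattice =
      ((PeriodPair.ofUpperHalfPlane UpperHalfPlane.ρ).mulLeft _ hc0).lattice := by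
    rw [lattice_mulLeft_comm _ hc0 I_ne_zero]
    exact PeriodPair.mulLeft_lattice_eq_of_lattice_eq hc0 (lattice_mulLeft_I_mulLeft_I _)
  rw [imaginaryPeriod_eq (⟨0, 0, 0, 0, a⟩ : WeierstrassCurve ℝ) (g₂_lattice_of_pos a ha.ne') (g₃_lattice_of_pos a ha),
    minRealPeriod_eq_of_lattice_eq hlat, minRealPeriod_mulLeft_ofReal _ hc, EisensteinLattice.minRealPeriod_eq, mul_one]

end Real

/-! ## §3 The sextic models over `ℚ` -/

section Rat

variable (k : ℤ)

/-- The base change to `ℝ` of `⟨0, 0, 0, 0, k⟩/ℚ` is `⟨0, 0, 0, 0, k⟩/ℝ`. [folklore] -/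
theorem baseChange_sextic :
    ((⟨0, 0, 0, 0, (k : ℚ)⟩ : WeierstrassCurve ℚ).baseChange ℝ) = (⟨0, 0, 0, 0, (k : ℝ)⟩ : WeierstrassCurve ℝ) := by
  ext <;> simp [WeierstrassCurve.baseChange, WeierstrassCurve.map]

/-- ★ `Ω⁺(⟨0,0,0,0,k⟩/ℚ) = ϖ₁|k|^{−1/6}` for `k < 0`. [cite: SilvermanAEC2009, Thm VI.5.1 and C.16] -/
theorem realPeriodRat_sextic_of_neg (hk : k < 0) :
    (⟨0, 0, 0, 0, (k : ℚ)⟩ : WeierstrassCurve ℚ).realPeriodRat =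
      ((2 : ℝ) ^ (2 / 3 : ℝ) * Real.Gamma (1 / 3) ^ 3 / (4 * Real.pi)) * |(k : ℝ)| ^ (-(1 / 6 : ℝ)) := by
  rw [realPeriodRat_def, baseChange_sextic, realPeriod_sextic_of_neg _ (by exact_mod_cast hk)]

/-- ★ `|Ω⁻(⟨0,0,0,0,k⟩/ℚ)| = √3·ϖ₁|k|^{−1/6}` for `k < 0`. [cite: Pal2012, p. 1514] -/
theorem imaginaryPeriodRat_sextic_of_neg (hk : k < 0) :
    (⟨0, 0, 0, 0, (k : ℚ)⟩ : WeierstrassCurve ℚ).imaginaryPeriodRat =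
      Real.sqrt 3 * (((2 : ℝ) ^ (2 / 3 : ℝ) * Real.Gamma (1 / 3) ^ 3 / (4 * Real.pi)) * |(k : ℝ)| ^ (-(1 / 6 : ℝ))) := by
  rw [imaginaryPeriodRat_def, baseChange_sextic, imaginaryPeriod_sextic_of_neg _ (by exact_mod_cast hk)]

/-- ★ `Ω⁺(⟨0,0,0,0,k⟩/ℚ) = √3·ϖ₁k^{−1/6}` for `k > 0`. [cite: SilvermanAEC2009, Thm VI.5.1 and C.16] -/
theorem realPeriodRat_sextic_of_pos (hk : 0 < k) :
    (⟨0, 0, 0, 0, (k : ℚ)⟩ : WeierstrassCurve ℚ).realPeriodRat =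
      Real.sqrt 3 * (((2 : ℝ) ^ (2 / 3 : ℝ) * Real.Gamma (1 / 3) ^ 3 / (4 * Real.pi)) * |(k : ℝ)| ^ (-(1 / 6 : ℝ))) := by
  rw [realPeriodRat_def, baseChange_sextic, realPeriod_sextic_of_pos _ (by exact_mod_cast hk)]

/-- ★ `|Ω⁻(⟨0,0,0,0,k⟩/ℚ)| = ϖ₁k^{−1/6}` for `k > 0`. [cite: Pal2012, p. 1514] -/
theorem imaginaryPeriodRat_sextic_of_pos (hk : 0 < k) :
    (⟨0, 0, 0, 0, (k : ℚ)⟩ : WeierstrassCurve ℚ).imaginaryPeriodRat =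
      ((2 : ℝ) ^ (2 / 3 : ℝ) * Real.Gamma (1 / 3) ^ 3 / (4 * Real.pi)) * |(k : ℝ)| ^ (-(1 / 6 : ℝ)) := by
  rw [imaginaryPeriodRat_def, baseChange_sextic, imaginaryPeriod_sextic_of_pos _ (by exact_mod_cast hk)]

/-- `√3` is an algebraic integer. [folklore] -/
theorem isIntegral_sqrt_three : IsIntegral ℤ ((Real.sqrt 3 : ℝ) : ℂ) := by
  refine IsIntegral.of_pow (n := 2) (by norm_num) ?_
  rw [← Complex.ofReal_pow, Real.sq_sqrt (by norm_num)]
  simpa using isIntegral_algebraMap (R := ℤ) (A := ℂ) (x := (3 : ℤ))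

/-- ★ **The imaginary period of the sextic model, assembly shape**: `|Ω⁻(⟨0,0,0,0,k⟩)| = c · ϖ₁ · |k|^{−1/6}` with `c ∈ {√3, 1}`, so
`c ≠ 0` and `3/c` is an algebraic integer. [cite: Pal2012, p. 1514] -/
theorem exists_imaginaryPeriodRat_sextic (hk : k ≠ 0) :
    ∃ c : ℝ, c ≠ 0 ∧ IsIntegral ℤ ((3 : ℂ) / (c : ℂ)) ∧
      (⟨0, 0, 0, 0, (k : ℚ)⟩ : WeierstrassCurve ℚ).imaginaryPeriodRat =
        c * (((2 : ℝ) ^ (2 / 3 : ℝ) * Real.Gamma (1 / 3) ^ 3 / (4 * Real.pi)) * |(k : ℝ)| ^ (-(1 / 6 : ℝ))) := by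
  rcases lt_or_gt_of_ne hk with h | h
  · refine ⟨Real.sqrt 3, (Real.sqrt_pos.mpr (by norm_num : (0 : ℝ) < 3)).ne', ?_, imaginaryPeriodRat_sextic_of_neg k h⟩
    have h3 : (3 : ℂ) / (Real.sqrt 3 : ℝ) = (Real.sqrt 3 : ℝ) := by
      have hs : ((Real.sqrt 3 : ℝ) : ℂ) ^ 2 = 3 := by rw [← Complex.ofReal_pow, Real.sq_sqrt (by norm_num)]; push_cast; ring
      have hs0 : ((Real.sqrt 3 : ℝ) : ℂ) ≠ 0 := Complex.ofReal_ne_zero.mpr (Real.sqrt_pos.mpr (by norm_num : (0 : ℝ) < 3)).ne'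
      field_simp
      linear_combination (-1 : ℂ) * hs
    rw [h3]
    exact isIntegral_sqrt_three
  · refine ⟨1, one_ne_zero, ?_, by rw [imaginaryPeriodRat_sextic_of_pos k h, one_mul]⟩
    simpa using isIntegral_algebraMap (R := ℤ) (A := ℂ) (x := (3 : ℤ))

end Rat

/-! ## §4 Period bookkeeping for the sextic assembly at a general prime `q` -/

/-- `k₁^{1/6}` is an algebraic integer for `k₁ ∈ ℕ`. [folklore] -/
theorem isIntegral_rpow_sixth (k₁ : ℕ) : IsIntegral ℤ ((((k₁ : ℝ) ^ (1 / 6 : ℝ) : ℝ)) : ℂ) := by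
  refine IsIntegral.of_pow (n := 6) (by norm_num) ?_
  rw [← Complex.ofReal_pow, ← Real.rpow_mul_natCast (by positivity)]
  norm_num
  simpa using isIntegral_algebraMap (R := ℤ) (A := ℂ) (x := (k₁ : ℤ))

/-- `|k|^{1/6} = q^{e/6} · k₁^{1/6}` for `|k| = q^e k₁`, read in `ℂ` as the inverse of `|k|^{−1/6}`. [folklore] -/
theorem inv_abs_rpow_neg_sixth_of_eq {q : ℕ} {k : ℤ} {e k₁ : ℕ} (hk : k.natAbs = q ^ e * k₁) :
    ((((|(k : ℝ)| ^ (-(1 / 6 : ℝ)) : ℝ)) : ℂ))⁻¹ = (q : ℂ) ^ ((e : ℂ) / 6) * ((((k₁ : ℝ) ^ (1 / 6 : ℝ) : ℝ)) : ℂ) := by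
  have habs : |(k : ℝ)| = (q : ℝ) ^ (e : ℝ) * (k₁ : ℝ) := by
    rw [← Int.cast_abs, ← Nat.cast_natAbs, hk, Real.rpow_natCast]; push_cast; ring
  rw [habs, Real.rpow_neg (by positivity), Complex.ofReal_inv, inv_inv,
    Real.mul_rpow (by positivity) (by positivity), ← Real.rpow_mul (by positivity), Complex.ofReal_mul,
    Complex.ofReal_cpow (by positivity : (0 : ℝ) ≤ q)]
  push_cast
  ring_nf

/-- `q^{e/6} · q^{(6−e)/6} = q` (`e ≤ 6`, `q ≠ 0`). [folklore] -/
theorem natCast_cpow_sixth_mul_cpow_sixth_of_le {q : ℕ} (hq : q ≠ 0) {e : ℕ} (he : e ≤ 6) :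
    (q : ℂ) ^ ((e : ℂ) / 6) * (q : ℂ) ^ (((6 - e : ℕ) : ℂ) / 6) = q := by
  rw [← Complex.cpow_add _ _ (Nat.cast_ne_zero.mpr hq), Nat.cast_sub he,
    show (e : ℂ) / 6 + ((6 : ℕ) - (e : ℂ)) / 6 = 1 by push_cast; ring, Complex.cpow_one]

end Summit.BirchSwinnertonDyer.BirchSwinnertonDyer.Theorems.BiquadraticEisensteinDescentManinDatumSupercuspidalCMInertSexticModelPeriods

end
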